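import Summits.QuantumFields.QCD.Theses.HeatSlicedQuarks
import Summits.QuantumFields.QCD.Theorems.SpectralDefectExtinctionTipNoBindingStubPositivity
import Literature.MathematicalPhysics.QuantumLattice.OverlapLocality
import Literature.MathematicalPhysics.QuantumLattice.WilsonDiracLowerBound

/-!
# Stub `stub_smoothFieldFloor` of line `low-mode-quarantine`
(crux `Summit.QuantumFields.QCD.Theses.HeatSlicedQuarks.RobustYangMillsHandover`,
item stmt-QuantumFields-8892)

**No quarantine on smooth fields.**  For every `m₀ ∈ (0, 1]` there is `ε₀ > 0` (here
`ε₀ = m₀⁴ / 7200`) such that on every periodic lattice `(ℤ/L)⁴`, for every `SU(3)` gauge field all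
of
whose plaquettes have trace deficit `3 − Re tr U_p ≤ ε₀`, and every mass `m ∈ [−1/2, 1]` with
`|m| ≥ m₀`, the `r = 1` Wilson–Dirac operator `D = wilsonDirac (fundamentalRep (Fin 3)) U m 1` obeys
`Σ_i ‖(D v)_i‖² ≥ (m₀²/2) Σ_i ‖v_i‖²` for every fermion field `v` — every singular value of `D` is
`≥ m₀/√2`, so the low singular block below the threshold `m₀²/4` is empty.

Proof.
* `m ≥ 0` (so `m ≥ m₀`): Wilson positivity (`stub_positivity`: `Re⟨v, D(0)v⟩ ≥ 0`) and
  `D(m) = D(0) + m·1` give `Re⟨v, D v⟩ ≥ m‖v‖²`, hence `‖D v‖ ≥ m‖v‖` by Cauchy–Schwarz; no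
  smoothness is used.
* `m < 0` (so `m ∈ [−1/2, −m₀]`): Neuberger's lower bound
  (`wilsonDirac_normSq_mulVec_ge_of_plaquette`, [Neuberger2000Bounds, §Lower bound]):
  `‖D v‖² ≥ (m² − 30δ)‖v‖²` whenever `‖1 − U_p‖ ≤ δ` for all plaquettes, `m ≥ −1`; the trace-deficit
  conversion `‖1 − u‖ ≤ √(2(3 − Re tr u))` (`norm_one_sub_le_sqrt_two_mul_trace_deficit`) gives
  `δ = √(2ε₀) = m₀²/60`, so `m² − 30δ ≥ m₀² − m₀²/2`.
-/

namespace Summit.QuantumFields.QCD.Cruxes.RobustYangMillsHandover.LowModeQuarantine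

open scoped BigOperators Classical Matrix
open Literature.MathematicalPhysics.QuantumFieldTheory
open Literature.MathematicalPhysics.QuantumLattice
open Literature.Probability.LatticeModels (TorusSite)
open Filter Topology

open Matrix Literature.MathematicalPhysics.QuantumLattice.NeubergerBound
open Summit.QuantumFields.QCD.Cruxes.TipNoBinding.PositivityNoLeakSpread (stub_positivity)

/-- `D_W(m) = D_W(0) + m·1`: only the diagonal of the Wilson matrix depends on the mass. -/
private theorem smoothFieldFloor_wilsonDirac_eq_add_mass {L : ℕ} [NeZero L]
    (U : GaugeConfig 4 L ↥(Matrix.specialUnitaryGroup (Fin 3) ℂ)) (m : ℝ) :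
    wilsonDirac (fundamentalRep (Fin 3)) U m 1 =
      wilsonDirac (fundamentalRep (Fin 3)) U 0 1 +
        (m : ℂ) •
          (1 : Matrix (TorusSite 4 L × Fin 3 × Fin 4) (TorusSite 4 L × Fin 3 × Fin 4) ℂ) := by
  ext p q
  simp only [wilsonDirac, Matrix.of_apply, Matrix.add_apply, Matrix.smul_apply, Matrix.one_apply,
    smul_eq_mul, mul_ite, mul_one, mul_zero]
  split_ifs <;> push_cast <;> ring

/-- **Accretivity floor** (no smoothness needed): `Re⟨v, D(m)v⟩ ≥ m‖v‖²`, hence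
`‖D(m) v‖² ≥ m²‖v‖²` for `m ≥ 0`. -/
private theorem smoothFieldFloor_of_nonneg_mass {L : ℕ} [NeZero L]
    (U : GaugeConfig 4 L ↥(Matrix.specialUnitaryGroup (Fin 3) ℂ)) {m : ℝ} (hm : 0 ≤ m)
    (v : TorusSite 4 L × Fin 3 × Fin 4 → ℂ) :
    m ^ 2 * ∑ i, ‖v i‖ ^ 2 ≤ ∑ i, ‖(wilsonDirac (fundamentalRep (Fin 3)) U m 1 *ᵥ v) i‖ ^ 2 := by
  have hre : m * eucNorm v ^ 2 ≤
      (star v ⬝ᵥ (wilsonDirac (fundamentalRep (Fin 3)) U m 1 *ᵥ v)).re := by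
    have h0 : 0 ≤ (star v ⬝ᵥ (wilsonDirac (fundamentalRep (Fin 3)) U 0 1 *ᵥ v)).re := by
      rw [stub_positivity L U v]; positivity
    rw [smoothFieldFloor_wilsonDirac_eq_add_mass, add_mulVec, smul_mulVec, one_mulVec,
      dotProduct_add,
      dotProduct_smul, Complex.add_re, smul_eq_mul, Complex.re_ofReal_mul, re_star_dotProduct_self]
    linarith
  have h1 : m * eucNorm v ^ 2 ≤
      eucNorm v * eucNorm (wilsonDirac (fundamentalRep (Fin 3)) U m 1 *ᵥ v) :=
    hre.trans ((le_abs_self _).trans (abs_re_star_dotProduct_le _ _))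
  rw [← eucNorm_sq_eq_sum, ← eucNorm_sq_eq_sum]
  rcases (eucNorm_nonneg v).eq_or_lt with h0 | hpos
  · rw [← h0]
    simp only [ne_eq, OfNat.ofNat_ne_zero, not_false_eq_true, zero_pow, mul_zero]
    positivity
  · have h2 : m * eucNorm v ≤ eucNorm (wilsonDirac (fundamentalRep (Fin 3)) U m 1 *ᵥ v) := by
      rw [pow_two, ← mul_assoc, mul_comm (eucNorm v) (eucNorm _)] at h1
      exact le_of_mul_le_mul_right h1 hpos
    calc m ^ 2 * eucNorm v ^ 2 = (m * eucNorm v) ^ 2 := by ring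
      _ ≤ _ := pow_le_pow_left₀ (mul_nonneg hm (eucNorm_nonneg _)) h2 2

open scoped Matrix.Norms.L2Operator in
/-- **stub_smoothFieldFloor — no quarantine on smooth fields** (registered stub of line
`low-mode-quarantine`): for `m₀ ∈ (0, 1]` and `ε₀ := m₀⁴/7200`, on every `(ℤ/L)⁴`, every `SU(3)`
field with all plaquette deficits `3 − Re tr U_p ≤ ε₀`, every `m ∈ [−1/2, 1]` with `|m| ≥ m₀` and
every `v`: `(m₀²/2) Σ‖v_i‖² ≤ Σ‖(D_W(U, m, 1) v)_i‖²`.  Positive masses by accretivity, negative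
masses by Neuberger's bound [Neuberger2000Bounds, §Lower bound] with `δ = √(2ε₀) = m₀²/60`. -/
theorem stub_smoothFieldFloor :
    ∀ m₀ : ℝ, 0 < m₀ → m₀ ≤ 1 → ∃ ε₀ : ℝ, 0 < ε₀ ∧
      ∀ (L : ℕ) [NeZero L] (U : GaugeConfig 4 L (Matrix.specialUnitaryGroup (Fin 3) ℂ)) (m : ℝ),
        m ∈ Set.Icc (-(1 / 2 : ℝ)) 1 → m₀ ≤ |m| →
        (∀ (y : TorusSite 4 L) (μ ν : Fin 4),
          3 - ((fundamentalRep (Fin 3) (plaquetteHolonomy U y μ ν)).trace).re ≤ ε₀) →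
          ∀ v : TorusSite 4 L × Fin 3 × Fin 4 → ℂ,
            m₀ ^ 2 / 2 * ∑ i, ‖v i‖ ^ 2 ≤
              ∑ i, ‖(wilsonDirac (fundamentalRep (Fin 3)) U m 1).mulVec v i‖ ^ 2 := by
  intro m₀ hm₀ _
  refine ⟨m₀ ^ 4 / 7200, by positivity, ?_⟩
  intro L _ U m hm hm₀m hU v
  have hsum : 0 ≤ ∑ i, ‖v i‖ ^ 2 := Finset.sum_nonneg fun i _ => by positivity
  rcases le_or_gt 0 m with hmnn | hmneg
  · -- non-negative mass: accretivity
    rw [abs_of_nonneg hmnn] at hm₀m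
    have hm2 : m₀ ^ 2 / 2 ≤ m ^ 2 := by nlinarith
    exact (mul_le_mul_of_nonneg_right hm2 hsum).trans (smoothFieldFloor_of_nonneg_mass U hmnn v)
  · -- negative mass `m ∈ [-1/2, -m₀]`: Neuberger's bound
    rw [abs_of_neg hmneg] at hm₀m
    set δ : ℝ := m₀ ^ 2 / 60 with hδ_def
    have hδ : 0 ≤ δ := by positivity
    have hδeq : Real.sqrt (2 * (m₀ ^ 4 / 7200)) = δ := by
      rw [show 2 * (m₀ ^ 4 / 7200) = (m₀ ^ 2 / 60) ^ 2 by ring, Real.sqrt_sq hδ]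
    have hplaq : ∀ (y : TorusSite 4 L) (μ ν : Fin 4), μ ≠ ν →
        ‖(1 : Matrix (Fin 3) (Fin 3) ℂ) - fundamentalRep (Fin 3) (plaquetteHolonomy U y μ ν)‖ ≤ δ :=
      by
      intro y μ ν _
      refine (norm_one_sub_le_sqrt_two_mul_trace_deficit _
        (fundamentalRep_mem_unitaryGroup _)).trans ?_
      rw [← hδeq]
      refine Real.sqrt_le_sqrt ?_
      have h := hU y μ ν
      push_cast
      linarith
    have hA := wilsonDirac_normSq_mulVec_ge_of_plaquette (fundamentalRep (Fin 3))
      fundamentalRep_mem_unitaryGroup U m (by linarith [hm.1]) δ hδ hplaq v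
    have hm2 : m₀ ^ 2 / 2 ≤ m ^ 2 - 30 * δ := by rw [hδ_def]; nlinarith
    exact (mul_le_mul_of_nonneg_right hm2 hsum).trans hA

end Summit.QuantumFields.QCD.Cruxes.RobustYangMillsHandover.LowModeQuarantine
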